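import Summits.Schanuel.Schanuel.Theses.RoyCriterion
import Literature.NumberTheory.Transcendental.RoySmallValueRoyD

/-!
# Box polynomials and Cauchy bounds for `𝒟₁` on monomials (lemmas for the Dirichlet edge of crux `stmt-Schanuel-1050`)

Support lemmas for `Negative/DirichletEdge.lean` (Dirichlet's box principle below the edge
`ν = 2 + β − τ` of `Summit.Schanuel.Schanuel.Theses.RoyCriterion.RoySmallValueDirichletGap`,
Roy 2013 = arXiv:1301.0663, p. 3):

* `norm_aeval_iterate_royD_monomial_le` — Cauchy's estimate on the unit circle for
  `z ↦ X₁ᵃX₂ᵇ(ξ + z, η e^z)`: `|𝒟₁ⁱ(X₁ᵃX₂ᵇ)(ξ, η)| ≤ i! R^D`, `R = (|ξ|+1)(e|η|+1)`, `a, b ≤ D`;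
* box polynomials `∑_{a,b ≤ H} d(a,b) X₁ᵃX₂ᵇ`: coefficients (`coeff_boxPoly_self`,
  `natAbs_coeff_boxPoly_le`), degree (`totalDegree_boxPoly_le`), and linearity of the values of
  `𝒟₁ⁱ` in `d` (`aeval_iterate_royD_boxPoly`);
* two small real lemmas (same `ε`-cell ⇒ distance `< ε`; eventual comparison of powers of `D`).

Everything is proved; no definitions, no named facts.
-/

noncomputable section

namespace Summit.Schanuel.Schanuel.Theorems.RoySmallValueDirichletGapDirichlet

open MvPolynomial Filter Complex Finset Metric
open Literature.NumberTheory.Transcendental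
open Literature.NumberTheory.Transcendental.Roy2013 (expEval2 differentiable_expEval2
  iteratedDeriv_expEval2_zero)

/-! ### Monomials: evaluation along the flow and Cauchy's estimate -/

/-- `X₁ᵃX₂ᵇ(ξ + z, η e^z) = (ξ+z)ᵃ (η e^z)ᵇ`. [folklore] -/
theorem expEval2_monomial (a b : ℕ) (ξ η z : ℂ) :
    expEval2 (X 0 ^ a * X 1 ^ b) ξ η z = (ξ + z) ^ a * (η * cexp z) ^ b := by
  simp [expEval2, map_mul, map_pow]

/-- On the unit circle, `|X₁ᵃX₂ᵇ(ξ + z, η e^z)| ≤ R^D` for `a, b ≤ D`, `R = (|ξ|+1)(e|η|+1)`.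
[folklore] -/
theorem norm_expEval2_monomial_le {a b D : ℕ} (ha : a ≤ D) (hb : b ≤ D) (ξ η : ℂ) {z : ℂ}
    (hz : ‖z‖ = 1) :
    ‖expEval2 (X 0 ^ a * X 1 ^ b) ξ η z‖ ≤ ((‖ξ‖ + 1) * (‖η‖ * Real.exp 1 + 1)) ^ D := by
  rw [expEval2_monomial, norm_mul, norm_pow, norm_pow, mul_pow]
  have h1 : ‖ξ + z‖ ≤ ‖ξ‖ + 1 := (norm_add_le _ _).trans (by rw [hz])
  have h2 : ‖η * cexp z‖ ≤ ‖η‖ * Real.exp 1 + 1 := by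
    rw [norm_mul, Complex.norm_exp]
    have : z.re ≤ 1 := (Complex.re_le_norm z).trans hz.le
    nlinarith [Real.exp_le_exp.2 this, norm_nonneg η, Real.exp_pos z.re]
  have hx1 : 1 ≤ ‖ξ‖ + 1 := by have := norm_nonneg ξ; linarith
  have hy1 : 1 ≤ ‖η‖ * Real.exp 1 + 1 := by
    have := mul_nonneg (norm_nonneg η) (Real.exp_pos 1).le; linarith
  gcongr
  · exact (pow_le_pow_left₀ (norm_nonneg _) h1 a).trans (pow_le_pow_right₀ hx1 ha)
  · exact (pow_le_pow_left₀ (norm_nonneg _) h2 b).trans (pow_le_pow_right₀ hy1 hb)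

/-- **Cauchy**: `|𝒟₁ⁱ(X₁ᵃX₂ᵇ)(ξ, η)| ≤ i! R^D` for `a, b ≤ D`. [folklore] -/
theorem norm_aeval_iterate_royD_monomial_le {a b D : ℕ} (ha : a ≤ D) (hb : b ≤ D) (ξ η : ℂ) (i : ℕ) :
    ‖aeval ![ξ, η] (royD^[i] (X 0 ^ a * X 1 ^ b))‖ ≤
      i.factorial * ((‖ξ‖ + 1) * (‖η‖ * Real.exp 1 + 1)) ^ D := by
  rw [← iteratedDeriv_expEval2_zero]
  have h := Complex.norm_iteratedDeriv_le_of_forall_mem_sphere_norm_le (f := expEval2 (X 0 ^ a * X 1 ^ b) ξ η)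
    (c := 0) i one_pos ((differentiable_expEval2 _ ξ η).diffContOnCl)
    (C := ((‖ξ‖ + 1) * (‖η‖ * Real.exp 1 + 1)) ^ D)
    (fun z hz => norm_expEval2_monomial_le ha hb ξ η (by simpa using hz))
  simpa using h

/-! ### Coefficient boxes -/

variable {H : ℕ}

/-- The polynomial with coefficient vector `d` on the monomials `X₁ᵃX₂ᵇ`, `a, b ≤ H`. -/
theorem boxPoly_def (d : Fin (H + 1) × Fin (H + 1) → ℤ) :
    (∑ k : Fin (H + 1) × Fin (H + 1), C (d k) * (X 0 ^ (k.1 : ℕ) * X 1 ^ (k.2 : ℕ)) :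
      MvPolynomial (Fin 2) ℤ) =
    ∑ k : Fin (H + 1) × Fin (H + 1),
      monomial (Finsupp.single 0 (k.1 : ℕ) + Finsupp.single 1 (k.2 : ℕ)) (d k) := by
  refine Finset.sum_congr rfl fun k _ => ?_
  rw [X_pow_eq_monomial, X_pow_eq_monomial, monomial_mul, C_mul_monomial]; simp

/-- The exponent map `(a, b) ↦ X₁ᵃX₂ᵇ` is injective. [folklore] -/
theorem expo_injective :
    Function.Injective fun k : Fin (H + 1) × Fin (H + 1) =>
      (Finsupp.single (0 : Fin 2) (k.1 : ℕ) + Finsupp.single 1 (k.2 : ℕ)) := by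
  intro k k' h
  have h0 := congrArg (fun f : Fin 2 →₀ ℕ => f 0) h
  have h1 := congrArg (fun f : Fin 2 →₀ ℕ => f 1) h
  simp at h0 h1
  exact Prod.ext (Fin.ext h0) (Fin.ext h1)

/-- Coefficients of a box polynomial. [folklore] -/
theorem coeff_boxPoly (d : Fin (H + 1) × Fin (H + 1) → ℤ) (m : Fin 2 →₀ ℕ) :
    coeff m (∑ k : Fin (H + 1) × Fin (H + 1), C (d k) * (X 0 ^ (k.1 : ℕ) * X 1 ^ (k.2 : ℕ)) :
      MvPolynomial (Fin 2) ℤ) =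
    ∑ k : Fin (H + 1) × Fin (H + 1),
      if Finsupp.single (0 : Fin 2) (k.1 : ℕ) + Finsupp.single 1 (k.2 : ℕ) = m then d k else 0 := by
  rw [boxPoly_def, coeff_sum]
  simp only [coeff_monomial]

/-- The coefficient at `X₁ᵃX₂ᵇ` is `d (a, b)`. [folklore] -/
theorem coeff_boxPoly_self (d : Fin (H + 1) × Fin (H + 1) → ℤ) (k₀ : Fin (H + 1) × Fin (H + 1)) :
    coeff (Finsupp.single (0 : Fin 2) (k₀.1 : ℕ) + Finsupp.single 1 (k₀.2 : ℕ))
      (∑ k : Fin (H + 1) × Fin (H + 1), C (d k) * (X 0 ^ (k.1 : ℕ) * X 1 ^ (k.2 : ℕ)) :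
        MvPolynomial (Fin 2) ℤ) = d k₀ := by
  rw [coeff_boxPoly]
  have : ∀ k : Fin (H + 1) × Fin (H + 1),
      (if Finsupp.single (0 : Fin 2) (k.1 : ℕ) + Finsupp.single 1 (k.2 : ℕ) =
          Finsupp.single (0 : Fin 2) (k₀.1 : ℕ) + Finsupp.single 1 (k₀.2 : ℕ) then d k else 0) =
      if k = k₀ then d k else 0 := by
    intro k
    by_cases hk : k = k₀
    · simp [hk]
    · rw [if_neg hk, if_neg (fun h => hk (expo_injective h))]
  simp_rw [this]
  simp

/-- Every coefficient of a box polynomial is one of the `d k`, or `0`. [folklore] -/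
theorem natAbs_coeff_boxPoly_le (d : Fin (H + 1) × Fin (H + 1) → ℤ) {A : ℕ}
    (hd : ∀ k, (d k).natAbs ≤ A) (m : Fin 2 →₀ ℕ) :
    (coeff m (∑ k : Fin (H + 1) × Fin (H + 1), C (d k) * (X 0 ^ (k.1 : ℕ) * X 1 ^ (k.2 : ℕ)) :
      MvPolynomial (Fin 2) ℤ)).natAbs ≤ A := by
  by_cases hm : ∃ k₀ : Fin (H + 1) × Fin (H + 1),
      Finsupp.single (0 : Fin 2) (k₀.1 : ℕ) + Finsupp.single 1 (k₀.2 : ℕ) = m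
  · obtain ⟨k₀, rfl⟩ := hm
    rw [coeff_boxPoly_self]; exact hd k₀
  · rw [coeff_boxPoly, Finset.sum_eq_zero fun k _ => if_neg fun h => hm ⟨k, h⟩]
    simp

/-- Degree of a box polynomial is `≤ 2H`. [folklore] -/
theorem totalDegree_boxPoly_le (d : Fin (H + 1) × Fin (H + 1) → ℤ) :
    (∑ k : Fin (H + 1) × Fin (H + 1), C (d k) * (X 0 ^ (k.1 : ℕ) * X 1 ^ (k.2 : ℕ)) :
      MvPolynomial (Fin 2) ℤ).totalDegree ≤ 2 * H := by
  rw [boxPoly_def]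
  refine totalDegree_finsetSum_le fun k _ => (totalDegree_monomial_le _ _).trans ?_
  rw [Finsupp.sum_add_index' (fun _ => rfl) (fun _ _ _ => rfl), Finsupp.sum_single_index rfl,
    Finsupp.sum_single_index rfl]
  show (k.1 : ℕ) + (k.2 : ℕ) ≤ 2 * H
  have := k.1.is_lt; have := k.2.is_lt; omega

/-- Values of `𝒟₁ⁱ` of a box polynomial are the corresponding linear combinations. [folklore] -/
theorem aeval_iterate_royD_boxPoly (d : Fin (H + 1) × Fin (H + 1) → ℤ) (ξ η : ℂ) (i : ℕ) :
    aeval ![ξ, η] (royD^[i] (∑ k : Fin (H + 1) × Fin (H + 1),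
      C (d k) * (X 0 ^ (k.1 : ℕ) * X 1 ^ (k.2 : ℕ)) : MvPolynomial (Fin 2) ℤ)) =
    ∑ k : Fin (H + 1) × Fin (H + 1),
      (d k : ℂ) * aeval ![ξ, η] (royD^[i] (X 0 ^ (k.1 : ℕ) * X 1 ^ (k.2 : ℕ))) := by
  rw [iterate_royD_sum, map_sum]
  refine Finset.sum_congr rfl fun k _ => ?_
  rw [iterate_royD_C_mul, map_mul, aeval_C]; simp

/-! ### Two small real lemmas -/

/-- Same `ε`-cell ⇒ distance `< ε`. [folklore] -/
theorem abs_sub_lt_of_floor_div_eq {x y ε : ℝ} (hε : 0 < ε) (h : ⌊x / ε⌋ = ⌊y / ε⌋) : |x - y| < ε := by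
  have h1 := Int.abs_sub_lt_one_of_floor_eq_floor h
  rw [← sub_div, abs_div, abs_of_pos hε, div_lt_one hε] at h1
  exact h1

/-- `C·D^a ≤ E·D^b` eventually in `D : ℕ`, for `a < b`, `E > 0`. [folklore] -/
theorem eventually_nat_rpow_le (C : ℝ) {a b E : ℝ} (hab : a < b) (hE : 0 < E) :
    ∀ᶠ D : ℕ in atTop, C * (D : ℝ) ^ a ≤ E * (D : ℝ) ^ b :=
  tendsto_natCast_atTop_atTop.eventually (eventually_mul_rpow_le_mul_rpow C hab hE)

/-- `C·D^a·log D ≤ E·D^b` eventually in `D : ℕ`, for `a < b`, `C ≥ 0`, `E > 0`. [folklore] -/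
theorem eventually_nat_rpow_log_le {C a b E : ℝ} (hab : a < b) (hC : 0 ≤ C) (hE : 0 < E) :
    ∀ᶠ D : ℕ in atTop, C * (D : ℝ) ^ a * Real.log D ≤ E * (D : ℝ) ^ b :=
  tendsto_natCast_atTop_atTop.eventually (eventually_mul_rpow_mul_log_le hab hC hE)

end Summit.Schanuel.Schanuel.Theorems.RoySmallValueDirichletGapDirichlet

end
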